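/-
Copyright (c) 2026 the pub-hodgecm-mathlib formalisation cell (harness21).  Prover seat hodgecm-mathlib-K2E4-p15 (g0), Track B ∕ K2-LIT
(build stream 29), h413 = `stmt-HodgeConjecture-24833`, line `K2_E4_SingularTransferKappaSign`, dealer pool H item H3 (DEAL K2E4-plan (g0) 2026-09-03T21:08:05Z).
-/
import Literature.NumberTheory.Rogawski1990.FinExplicitTransferFactorGHRegular        -- ★ (P-β) `finKappaAt_rationalComponent_eq_one_or_eq_neg_one_of_eval_ne_zero`, `finTau_ne_zero_of_isUnit`
import Literature.NumberTheory.Rogawski1990.FinExplicitTransferFactorScalarPartner    -- ★ D-S2s `finWeylRatio_of_fst_eq_smul_one(_of_split)`, `finKappaAt_of_fst_eq_smul_one_eq_ite`, `eval_charpoly_of_fst_eq_smul_one_rational`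
import Literature.NumberTheory.Rogawski1990.ExplicitFactorRationalLocalisation        -- ★ `finTau_rationalComponent`, `finEigenlineProjector_rationalComponent`, `finColumnFormValue_rationalComponent`, `coe_coe_toLocal_toAdelic`
import Literature.NumberTheory.Rogawski1990.AdelicStableClassesProductGp              -- ★ `isLocalNormPair_rationalComponent_toLocal_toAdelic`
import Summits.HodgeConjecture.HodgeConjecture.Theorems.K2E4ExplicitSingularPairNondegenerate   -- ★ p854779 `isNormPair_of_scalarPartner` (socket #15's §1)
import HarnessLib

/-!
# h413 ∕ Track B «K2-LIT», line `K2_E4_SingularTransferKappaSign`, pool H3: CLOSED FORMS OF `τ_v`, `D_{G∕H,v}`, `P_v`, `κ_v`, `Δ‴_v` AT THE SEMIREGULAR PAIR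

Cell `pub/hodgecm-mathlib`, crux H413 = `stmt-HodgeConjecture-24833`; chair K2-lead (g0), dealer K2E4-plan (g0), pool item H3 `Theorems/K2E4SingularPairWeylKappaValues.lean`
(DEALS 21:08:05Z ↦ seat K2E4-p15; consumers: sockets #2 `sig_K2E4ExplicitSplitConstantPhase`, #4 `sig_K2E4ExplicitNonsplitConstantPhase`, #16).  THEOREMS ONLY
(no `def`∕`instance`∕`notation`∕named-fact hypothesis∕`sorry`); FRAME-FREE (the sockets' rational binders `γ_H = (e₁·1₂, e₂)`, `γ₀`, `hsplit∕hnc∕hχ∕h1∕h2`, byte-compatible);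
imports ★ Literature + ★ `Theorems/K2E4ExplicitSingularPairNondegenerate` (p854779) + HarnessLib; lane `--supports stmt-HodgeConjecture-24833 --as helper` (count-neutral).

THE MATHEMATICS [Rogawski1990 §4.9 p. 55; Prop. 8.2.1 (a) pp. 117–119; §14.6 p. 242].  At a finite `v` of `L⁺` (`E_v = ∏_{w∣v} L_w`), for the rational scalar partner
`γ_H = (e₁·1₂, e₂)` and print's semiregular `γ₀ ∈ U(H′)(L⁺)` (`(γ₀ − e₁)(γ₀ − e₂) = 0`, `e₁ ≠ e₂`, non-central, `charpoly γ₀ = (X − e₁)²(X − e₂)`):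
§1 `γ₂((γ_H)_v) = e₂ ⊗ 1`, `χ_g(γ₂) = (e₂ − e₁)² ⊗ 1` a UNIT (`(G,H)`-regular though `G`-singular); `τ_v((γ_H)_v) = μ_v(e₂ ⊗ 1)·μ_v((−(e₂ − e₁)²(e₁²)⁻¹) ⊗ 1)⁻¹ ≠ 0`;
`D_{G∕H,v}((γ_H)_v) = ∏_{w∣v} ‖e₂ − e₁‖_w > 0`, `= ‖e₂ − e₁‖_w²∕(‖e₁‖_w‖e₂‖_w)` at a split `v` [Lemma 4.13.1 p. 64].  §2 the global projector
`γ₀² − tr(e₁·1₂)γ₀ + det(e₁·1₂) = (γ₀ − e₁)² = (e₂ − e₁)(γ₀ − e₁) ≠ 0` (columns span the `e₂`-eigenLINE `ker(γ₀ − e₂)`), `P_v((γ_H)_v, (γ₀)_v) = P ⊗ 1 ≠ 0`.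
§3 `(γ_H)_v → (γ₀)_v` (★ p854779 localised), so `κ_v = ±1`, `= +1` at split `v`; at a NON-SPLIT `v`, `κ_v = +1` iff `⟨p, p⟩_{H′} ⊗ 1 = z z̄` for a unit `z` of `L_w`, `p` any
non-zero column of `γ₀ − e₁` — the local Hilbert symbol `(⟨p, p⟩_{H′}, L∕L⁺)_v` on the `e₂`-eigenline (Kottwitz's invariant).  §4 `Δ‴_v((γ_H)_v, (γ₀)_v) = τ_v·(D_v κ_v)`,
`D_v κ_v ∈ ℝ^×` (`> 0` at split `v`): the PHASE of `Δ‴_v` at the pair is that of `τ_v` — the input of the phase pins #2∕#4 (Prop. 8.2.1 (a), compatible measures) —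
stated in the sockets' spelling `(toLocal v (toAdelic γ_H.1), toLocal v (toAdelic γ_H.2))` ∕ `toLocal v (toAdelic γ₀)` (★ `rationalComponent L γ_H v` is that pair by `rfl`;
the split closed form of `Δ‴_v` is `finExplicitDelta_singularPair_eq` + `finTau_singularPair` + `finWeylRatio_singularPair_of_split` + `finKappaAt_singularPair_of_not_subsingleton`).

HONEST LABEL.  HC_CM is proved only modulo the 7 printed citations (2 remaining named inputs: hLiu418 = `stmt-HodgeConjecture-24832`, h413 = `stmt-HodgeConjecture-24833`)
until rung 0 closes; this file moves no counter.  ED. 2 = ED. 1 (★ p854878) with docstring-only page folds per lit1 (5152): Lemma 4.13.1 → p. 64, Prop. 3.5.2 (c) → pp. 25–26.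

## References
* [Rogawski1990] J. D. Rogawski, *Automorphic Representations of Unitary Groups in Three Variables*, Ann. of Math. Stud. 123 (1990): §4.9 p. 55, Lemma 4.13.1 p. 64,
  §8.2 Prop. 8.2.1 pp. 117–119, §14.6 p. 242, §3.5 Prop. 3.5.2 (c) pp. 25–26.
* [LanglandsShelstad1987] R. P. Langlands, D. Shelstad, *On the definition of transfer factors*, Math. Ann. 278 (1987), §1–§2.
-/

set_option autoImplicit false
-- the mandated namespace repeats the single-problem summit's segment (`HodgeConjecture.HodgeConjecture`)
set_option linter.dupNamespace false

noncomputable section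

open NumberField IsDedekindDomain Matrix Polynomial
open Literature.NumberTheory.Rogawski1990 Literature.NumberTheory.Automorphic Literature.NumberTheory.GaloisRepresentations
open Literature.AlgebraicGeometry.ShimuraVarieties (unitaryGroup hermForm)
open Summit.HodgeConjecture.HodgeConjecture.Cruxes.H413.K2E4ExplicitSingularPairNondegenerate (isNormPair_of_scalarPartner)
open scoped MatrixGroups

namespace Summit.HodgeConjecture.HodgeConjecture.Cruxes.H413.K2E4SingularPairWeylKappaValues

variable (L : Type) [Field L] [NumberField L] [IsCMField L]

omit [NumberField L] [IsCMField L] in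
/-- `(e·1) pushed along a ring map is `f(e)·1` (bookkeeping). [folklore] -/
theorem smul_one_map {n : Type*} [Fintype n] [DecidableEq n] {S : Type*} [CommRing S] (f : L →+* S) (e : L) :
    (e • (1 : Matrix n n L)).map f = f e • (1 : Matrix n n S) := by
  ext a b
  by_cases hab : a = b
  · subst hab; simp
  · simp [Matrix.one_apply_ne hab]

/-! ## §1 The `H`-side values at `(γ_H)_v`, `γ_H = (e₁·1₂, e₂)` rational -/

section HSide

variable
  (γH : (UnitaryGroup.cmDatum L 2 (Matrix.of fun i j : Fin 2 => if i.val + j.val + 1 = 2 then (1 : L) else 0)).Rational ×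
    (UnitaryGroup.cmDatum L 1 (Matrix.of fun i j : Fin 1 => if i.val + j.val + 1 = 1 then (1 : L) else 0)).Rational)
  {e₁ e₂ : L}
  (h1 : (((γH.1 : unitaryGroup (cmConjRingHom L) (Matrix.of fun i j : Fin 2 => if i.val + j.val + 1 = 2 then (1 : L) else 0)).val : GL (Fin 2) L) :
      Matrix (Fin 2) (Fin 2) L) = e₁ • (1 : Matrix (Fin 2) (Fin 2) L))
  (h2 : (((γH.2 : unitaryGroup (cmConjRingHom L) (Matrix.of fun i j : Fin 1 => if i.val + j.val + 1 = 1 then (1 : L) else 0)).val : GL (Fin 1) L) :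
      Matrix (Fin 1) (Fin 1) L) 0 0 = e₂)
  (v : HeightOneSpectrum (𝓞 ↥(maximalRealSubfield L)))

include h1 in
/-- **`(γ_H.1)_v = (e₁ ⊗ 1)·1₂`**: the local first block of the scalar partner is scalar (★ `coe_coe_toLocal_toAdelic`). [cite: Rogawski1990, §8.2 p. 117] -/
theorem coe_fst_singularPair :
    ((rationalComponent L γH v).1.val.val : Matrix (Fin 2) (Fin 2) (UnitaryGroup.LocalRing L v)) =
      algebraMap L (UnitaryGroup.LocalRing L v) e₁ • (1 : Matrix (Fin 2) (Fin 2) (UnitaryGroup.LocalRing L v)) := by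
  unfold rationalComponent
  rw [coe_coe_toLocal_toAdelic, h1, smul_one_map]

include h2 in
/-- **`γ₂((γ_H)_v) = e₂ ⊗ 1`** (★ `finGammaTwo_rationalComponent`). [cite: Rogawski1990, §4.9 p. 55] -/
theorem finGammaTwo_singularPair : finGammaTwo L v (rationalComponent L γH v) = algebraMap L (UnitaryGroup.LocalRing L v) e₂ := by
  rw [finGammaTwo_rationalComponent]
  exact congrArg _ h2

include h1 h2 in
/-- **`χ_g(γ₂)((γ_H)_v) = (e₂ − e₁)² ⊗ 1`** (★ `eval_finCharpolyTwo_of_fst_eq_smul_one`). [cite: Rogawski1990, §4.9 p. 55; Prop. 8.2.1 (a) p. 118] -/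
theorem eval_finCharpolyTwo_singularPair :
    (finCharpolyTwo L v (rationalComponent L γH v)).eval (finGammaTwo L v (rationalComponent L γH v)) =
      algebraMap L (UnitaryGroup.LocalRing L v) ((e₂ - e₁) ^ 2) := by
  rw [eval_finCharpolyTwo_of_fst_eq_smul_one L v (rationalComponent L γH v) (coe_fst_singularPair L γH h1 v), finGammaTwo_singularPair L γH h2 v,
    map_pow, map_sub]

include h1 h2 in
/-- **`(G,H)`-regularity of the pair: `χ_g(γ₂)((γ_H)_v)` is a UNIT of `E_v`** for `e₁ ≠ e₂` (a non-zero field element maps to a unit). [cite: Rogawski1990, Prop. 8.2.1 (a) p. 118] -/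
theorem isUnit_eval_finCharpolyTwo_singularPair (he : e₁ ≠ e₂) :
    IsUnit ((finCharpolyTwo L v (rationalComponent L γH v)).eval (finGammaTwo L v (rationalComponent L γH v))) := by
  rw [eval_finCharpolyTwo_singularPair L γH h1 h2 v]
  exact (isUnit_iff_ne_zero.2 (pow_ne_zero 2 (sub_ne_zero.2 he.symm))).map _

include h1 h2 in
/-- **`χ_g(u) ≠ 0` in `L`** for `e₁ ≠ e₂` (★ `eval_charpoly_ne_zero_iff_of_fst_eq_smul_one_rational`) — the `hχ` guard of ★ (P-β)∕(P-γ). [cite: Rogawski1990, Prop. 8.2.1 (a) p. 118] -/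
theorem eval_charpoly_singularPair_ne_zero (he : e₁ ≠ e₂) :
    ((γH.1.val.val : Matrix (Fin 2) (Fin 2) L).charpoly).eval ((γH.2.val.val : Matrix (Fin 1) (Fin 1) L) 0 0) ≠ 0 := by
  rw [eval_charpoly_ne_zero_iff_of_fst_eq_smul_one_rational L γH h1, h2]
  exact he.symm

include h1 in
/-- `det (γ_H.1)⁻¹ = (e₁²)⁻¹` for the scalar block. [cite: Rogawski1990, §4.9 p. 55] -/
theorem det_inv_fst_singularPair : (((γH.1.val⁻¹).val : Matrix (Fin 2) (Fin 2) L)).det = (e₁ ^ 2)⁻¹ := by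
  have hd : ((γH.1.val.val : Matrix (Fin 2) (Fin 2) L)).det = e₁ ^ 2 := by
    rw [h1, Matrix.det_smul, Matrix.det_one, mul_one, Fintype.card_fin]
  have hmul : (((γH.1.val⁻¹).val : Matrix (Fin 2) (Fin 2) L)).det * ((γH.1.val.val : Matrix (Fin 2) (Fin 2) L)).det = 1 := by
    rw [← Matrix.det_mul, ← Units.val_mul, inv_mul_cancel, Units.val_one, Matrix.det_one]
  rw [hd] at hmul
  exact eq_inv_of_mul_eq_one_left hmul

include h1 h2 in
/-- **`τ_v((γ_H)_v) = μ_v(e₂ ⊗ 1) · μ_v((−(e₂ − e₁)²·(e₁²)⁻¹) ⊗ 1)⁻¹`** — print's `μ(γ₂) μ⁻¹((γ₂γ₁⁻¹ − 1)(1 − γ₂γ₃⁻¹))` at `γ₁ = γ₃ = e₁`, `γ₂ = e₂` (★ `finTau_rationalComponent`). [cite: Rogawski1990, §4.9 p. 55] -/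
theorem finTau_singularPair (μ : HeckeCharacter L) :
    finTau L v (rationalComponent L γH v) μ =
      finHeckeValue L v μ (algebraMap L (UnitaryGroup.LocalRing L v) e₂) *
        (finHeckeValue L v μ (algebraMap L (UnitaryGroup.LocalRing L v) (-((e₂ - e₁) ^ 2) * (e₁ ^ 2)⁻¹)))⁻¹ := by
  rw [finTau_rationalComponent, eval_charpoly_of_fst_eq_smul_one_rational L γH h1, det_inv_fst_singularPair L γH h1, h2]

include h1 h2 in
/-- **`τ_v((γ_H)_v) ≠ 0`** for `e₁ ≠ e₂` (★ `finTau_ne_zero_of_isUnit`). [cite: Rogawski1990, §4.9 p. 55] -/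
theorem finTau_singularPair_ne_zero (μ : HeckeCharacter L) (he : e₁ ≠ e₂) : finTau L v (rationalComponent L γH v) μ ≠ 0 :=
  finTau_ne_zero_of_isUnit L v (rationalComponent L γH v) μ (isUnit_eval_finCharpolyTwo_singularPair L γH h1 h2 v he)

include h1 h2 in
/-- **`D_{G∕H,v}((γ_H)_v) = ∏_{w∣v} ‖e₂ − e₁‖_w`** at every finite `v` (★ `finWeylRatio_of_fst_eq_smul_one`). [cite: Rogawski1990, §4.9 p. 55; Prop. 8.2.1 (a) p. 118] -/
theorem finWeylRatio_singularPair :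
    finWeylRatio L v (rationalComponent L γH v) = ∏ w : UnitaryGroup.PlacesOver L v, ‖algebraMap L (w.1.adicCompletion L) (e₂ - e₁)‖ := by
  rw [finWeylRatio_of_fst_eq_smul_one L v (rationalComponent L γH v) (coe_fst_singularPair L γH h1 v), finGammaTwo_singularPair L γH h2 v, ← map_sub]
  rfl

include h1 h2 in
/-- **`D_{G∕H,v}((γ_H)_v) > 0`** for `e₁ ≠ e₂`. [cite: Rogawski1990, §4.9 p. 55] -/
theorem finWeylRatio_singularPair_pos (he : e₁ ≠ e₂) : 0 < finWeylRatio L v (rationalComponent L γH v) := by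
  rw [finWeylRatio_singularPair L γH h1 h2 v]
  exact Finset.prod_pos fun w _ => norm_pos_iff.2 ((_root_.map_ne_zero _).2 (sub_ne_zero.2 he.symm))

include h1 h2 in
/-- **`D_{G∕H,v}((γ_H)_v) = ‖e₂ − e₁‖_w²∕(‖e₁‖_w‖e₂‖_w)` AT A SPLIT PLACE** (`w ∣ v`, `w̄ ≠ w`; ★ `finWeylRatio_of_fst_eq_smul_one_of_split`). [cite: Rogawski1990, Lemma 4.13.1 p. 64; Prop. 8.2.1 (a) p. 118] -/
theorem finWeylRatio_singularPair_of_split (w : UnitaryGroup.PlacesOver L v) (hw : IsCMField.complexConj L • w.1 ≠ w.1) :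
    finWeylRatio L v (rationalComponent L γH v) =
      ‖algebraMap L (w.1.adicCompletion L) (e₂ - e₁)‖ ^ 2 * ‖algebraMap L (w.1.adicCompletion L) e₁‖⁻¹ * ‖algebraMap L (w.1.adicCompletion L) e₂‖⁻¹ := by
  rw [finWeylRatio_of_fst_eq_smul_one_of_split L v (rationalComponent L γH v) (coe_fst_singularPair L γH h1 v) w hw, finGammaTwo_singularPair L γH h2 v,
    ← map_sub]
  rfl

end HSide

/-! ## §2 The projector `P_v((γ_H)_v, (γ₀)_v) = ((e₂ − e₁)·(γ₀ − e₁)) ⊗ 1 ≠ 0` -/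

section Pair

variable (H' : Matrix (Fin 3) (Fin 3) L) (hherm : (H'.map (cmConjRingHom L)).transpose = H')
  (hanis : ∀ x : Fin 3 → L, hermForm (cmConjRingHom L) H' x x = 0 → x = 0)
  (γ₀ : (UnitaryGroup.cmDatum L 3 H').Rational) {e₁ e₂ : L} (he : e₁ ≠ e₂)
  (hsplit : ((((γ₀ : unitaryGroup (cmConjRingHom L) H').val : GL (Fin 3) L) : Matrix (Fin 3) (Fin 3) L) - e₁ • (1 : Matrix (Fin 3) (Fin 3) L)) *
      ((((γ₀ : unitaryGroup (cmConjRingHom L) H').val : GL (Fin 3) L) : Matrix (Fin 3) (Fin 3) L) - e₂ • (1 : Matrix (Fin 3) (Fin 3) L)) = 0)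
  (hnc : ¬ ∃ ζ : L, (((γ₀ : unitaryGroup (cmConjRingHom L) H').val : GL (Fin 3) L) : Matrix (Fin 3) (Fin 3) L) = ζ • (1 : Matrix (Fin 3) (Fin 3) L))
  (hχ : (((γ₀ : unitaryGroup (cmConjRingHom L) H').val : GL (Fin 3) L) : Matrix (Fin 3) (Fin 3) L).charpoly =
    (Polynomial.X - Polynomial.C e₁) ^ 2 * (Polynomial.X - Polynomial.C e₂))
  (γH : (UnitaryGroup.cmDatum L 2 (Matrix.of fun i j : Fin 2 => if i.val + j.val + 1 = 2 then (1 : L) else 0)).Rational ×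
    (UnitaryGroup.cmDatum L 1 (Matrix.of fun i j : Fin 1 => if i.val + j.val + 1 = 1 then (1 : L) else 0)).Rational)
  (h1 : (((γH.1 : unitaryGroup (cmConjRingHom L) (Matrix.of fun i j : Fin 2 => if i.val + j.val + 1 = 2 then (1 : L) else 0)).val : GL (Fin 2) L) :
      Matrix (Fin 2) (Fin 2) L) = e₁ • (1 : Matrix (Fin 2) (Fin 2) L))
  (h2 : (((γH.2 : unitaryGroup (cmConjRingHom L) (Matrix.of fun i j : Fin 1 => if i.val + j.val + 1 = 1 then (1 : L) else 0)).val : GL (Fin 1) L) :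
      Matrix (Fin 1) (Fin 1) L) 0 0 = e₂)
  (v : HeightOneSpectrum (𝓞 ↥(maximalRealSubfield L)))

include hsplit in
/-- **`(γ₀ − e₁)² = (e₂ − e₁)·(γ₀ − e₁)`** from `(γ₀ − e₁)(γ₀ − e₂) = 0`. [cite: Rogawski1990, §8.2 p. 117] -/
theorem sub_smul_one_sq_eq_smul :
    ((((γ₀ : unitaryGroup (cmConjRingHom L) H').val : GL (Fin 3) L) : Matrix (Fin 3) (Fin 3) L) - e₁ • (1 : Matrix (Fin 3) (Fin 3) L)) ^ 2 =
      (e₂ - e₁) • ((((γ₀ : unitaryGroup (cmConjRingHom L) H').val : GL (Fin 3) L) : Matrix (Fin 3) (Fin 3) L) - e₁ • (1 : Matrix (Fin 3) (Fin 3) L)) := by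
  set X := (((γ₀ : unitaryGroup (cmConjRingHom L) H').val : GL (Fin 3) L) : Matrix (Fin 3) (Fin 3) L) with hX
  calc (X - e₁ • 1) ^ 2 = (X - e₁ • 1) * ((X - e₂ • 1) + (e₂ • 1 - e₁ • 1)) := by rw [sq, sub_add_sub_cancel]
    _ = (X - e₁ • 1) * (X - e₂ • 1) + (X - e₁ • 1) * (e₂ • 1 - e₁ • 1) := mul_add _ _ _
    _ = (e₂ - e₁) • (X - e₁ • 1) := by rw [hsplit, zero_add, ← sub_smul, mul_smul_comm, mul_one]

include hsplit h1 in
/-- **The GLOBAL projector of ★ `finEigenlineProjector_rationalComponent` at the pair**: `γ₀² − tr(e₁·1₂)γ₀ + det(e₁·1₂) = (γ₀ − e₁)² = (e₂ − e₁)(γ₀ − e₁)`. [cite: Rogawski1990, §4.9 p. 55] -/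
theorem globalProjector_singularPair :
    (γ₀.val.val : Matrix (Fin 3) (Fin 3) L) * γ₀.val.val - (γH.1.val.val : Matrix (Fin 2) (Fin 2) L).trace • (γ₀.val.val : Matrix (Fin 3) (Fin 3) L) +
        (γH.1.val.val : Matrix (Fin 2) (Fin 2) L).det • (1 : Matrix (Fin 3) (Fin 3) L) =
      (e₂ - e₁) • ((((γ₀ : unitaryGroup (cmConjRingHom L) H').val : GL (Fin 3) L) : Matrix (Fin 3) (Fin 3) L) - e₁ • (1 : Matrix (Fin 3) (Fin 3) L)) := by
  rw [← sub_smul_one_sq_eq_smul L H' γ₀ hsplit, h1, Matrix.trace_smul, Matrix.trace_one, Matrix.det_smul, Matrix.det_one, mul_one, Fintype.card_fin]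
  set X := (((γ₀ : unitaryGroup (cmConjRingHom L) H').val : GL (Fin 3) L) : Matrix (Fin 3) (Fin 3) L) with hX
  have hexp : (X - e₁ • (1 : Matrix (Fin 3) (Fin 3) L)) ^ 2 = X * X - e₁ • X - e₁ • X + (e₁ * e₁) • (1 : Matrix (Fin 3) (Fin 3) L) := by
    simp only [sq, sub_mul, mul_sub, smul_mul_assoc, mul_smul_comm, one_mul, mul_one, smul_sub, smul_smul]
    abel
  rw [hexp, smul_eq_mul, Nat.cast_ofNat, mul_two, add_smul, sq]
  abel

include he hnc in
/-- **`(e₂ − e₁)·(γ₀ − e₁) ≠ 0`** for `e₁ ≠ e₂` and `γ₀` non-central. [cite: Rogawski1990, §8.2 p. 117] -/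
theorem smul_sub_smul_one_ne_zero :
    (e₂ - e₁) • ((((γ₀ : unitaryGroup (cmConjRingHom L) H').val : GL (Fin 3) L) : Matrix (Fin 3) (Fin 3) L) - e₁ • (1 : Matrix (Fin 3) (Fin 3) L)) ≠ 0 := by
  intro h0
  have hne : (e₂ - e₁) ≠ 0 := sub_ne_zero.2 he.symm
  have hM : (((γ₀ : unitaryGroup (cmConjRingHom L) H').val : GL (Fin 3) L) : Matrix (Fin 3) (Fin 3) L) - e₁ • (1 : Matrix (Fin 3) (Fin 3) L) = 0 := by
    have h' := congrArg (fun M : Matrix (Fin 3) (Fin 3) L => (e₂ - e₁)⁻¹ • M) h0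
    simpa only [smul_smul, inv_mul_cancel₀ hne, one_smul, smul_zero] using h'
  exact hnc ⟨e₁, sub_eq_zero.1 hM⟩

include hsplit h1 in
/-- **`P_v((γ_H)_v, (γ₀)_v) = ((e₂ − e₁)·(γ₀ − e₁)) ⊗ 1`** (★ `finEigenlineProjector_rationalComponent`). [cite: Rogawski1990, §4.9 p. 55; §14.6 p. 242] -/
theorem finEigenlineProjector_singularPair :
    finEigenlineProjector L v H' (rationalComponent L γH v) ((UnitaryGroup.cmDatum L 3 H').toLocal v ((UnitaryGroup.cmDatum L 3 H').toAdelic γ₀)) =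
      ((e₂ - e₁) • ((((γ₀ : unitaryGroup (cmConjRingHom L) H').val : GL (Fin 3) L) : Matrix (Fin 3) (Fin 3) L) - e₁ • (1 : Matrix (Fin 3) (Fin 3) L))).map
        (algebraMap L (UnitaryGroup.LocalRing L v)) := by
  rw [finEigenlineProjector_rationalComponent, globalProjector_singularPair L H' γ₀ hsplit γH h1]

include he hsplit hnc h1 in
/-- **`P_v((γ_H)_v, (γ₀)_v) ≠ 0`** (`L → E_v` is injective, ★ `algebraMap_localRing_injective`). [cite: Rogawski1990, §4.9 p. 55] -/
theorem finEigenlineProjector_singularPair_ne_zero :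
    finEigenlineProjector L v H' (rationalComponent L γH v) ((UnitaryGroup.cmDatum L 3 H').toLocal v ((UnitaryGroup.cmDatum L 3 H').toAdelic γ₀)) ≠ 0 := by
  rw [finEigenlineProjector_singularPair L H' γ₀ hsplit γH h1 v, Ne, ← Matrix.map_zero (algebraMap L (UnitaryGroup.LocalRing L v)) (map_zero _),
    (Matrix.map_injective (algebraMap_localRing_injective L v)).eq_iff]
  exact smul_sub_smul_one_ne_zero L H' γ₀ he hnc

include he hsplit in
/-- A non-zero column `j` of `γ₀ − e₁` is a non-zero column of `((γ₀)_v − e₁ ⊗ 1)²` (the column input of ★ `finKappaAt_of_fst_eq_smul_one_eq_ite`). [cite: Rogawski1990, §3.5 Prop. 3.5.2 (c) pp. 25–26] -/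
theorem column_sq_ne_zero {j : Fin 3}
    (hj : ∃ i : Fin 3, ((((γ₀ : unitaryGroup (cmConjRingHom L) H').val : GL (Fin 3) L) : Matrix (Fin 3) (Fin 3) L) - e₁ • (1 : Matrix (Fin 3) (Fin 3) L)) i j ≠ 0) :
    (fun i => (((((UnitaryGroup.cmDatum L 3 H').toLocal v ((UnitaryGroup.cmDatum L 3 H').toAdelic γ₀)).val.val : Matrix (Fin 3) (Fin 3) (UnitaryGroup.LocalRing L v)) -
        algebraMap L (UnitaryGroup.LocalRing L v) e₁ • (1 : Matrix (Fin 3) (Fin 3) (UnitaryGroup.LocalRing L v))) ^ 2 : Matrix (Fin 3) (Fin 3) (UnitaryGroup.LocalRing L v)) i j) ≠ 0 := by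
  obtain ⟨i, hi⟩ := hj
  have hloc : ((((UnitaryGroup.cmDatum L 3 H').toLocal v ((UnitaryGroup.cmDatum L 3 H').toAdelic γ₀)).val.val : Matrix (Fin 3) (Fin 3) (UnitaryGroup.LocalRing L v)) -
        algebraMap L (UnitaryGroup.LocalRing L v) e₁ • (1 : Matrix (Fin 3) (Fin 3) (UnitaryGroup.LocalRing L v))) =
      ((((γ₀ : unitaryGroup (cmConjRingHom L) H').val : GL (Fin 3) L) : Matrix (Fin 3) (Fin 3) L) - e₁ • (1 : Matrix (Fin 3) (Fin 3) L)).map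
        (algebraMap L (UnitaryGroup.LocalRing L v)) := by
    rw [coe_coe_toLocal_toAdelic, Matrix.map_sub _ (map_sub _), smul_one_map]
  intro h0
  have h0i : _ = (0 : UnitaryGroup.LocalRing L v) := congrFun h0 i
  rw [hloc, ← Matrix.map_pow, sub_smul_one_sq_eq_smul L H' γ₀ hsplit, Matrix.map_apply, map_eq_zero_iff _ (algebraMap_localRing_injective L v),
    Matrix.smul_apply, smul_eq_mul] at h0i
  exact (mul_ne_zero (sub_ne_zero.2 he.symm) hi) h0i

/-! ## §3 Matching and the sign `κ_v` at the pair -/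

include hherm hanis he hsplit hnc hχ h1 h2 in
/-- **`(γ_H)_v → (γ₀)_v` AT EVERY FINITE `v`**: ★ p854779 `isNormPair_of_scalarPartner` localised (★ `isLocalNormPair_rationalComponent_toLocal_toAdelic`). [cite: Rogawski1990, §4.9 p. 54; §14.1 p. 232] -/
theorem isLocalNormPair_singularPair :
    IsLocalNormPair L H' v (rationalComponent L γH v) ((UnitaryGroup.cmDatum L 3 H').toLocal v ((UnitaryGroup.cmDatum L 3 H').toAdelic γ₀)) :=
  isLocalNormPair_rationalComponent_toLocal_toAdelic (isNormPair_of_scalarPartner L H' hherm hanis γ₀ he hsplit hnc hχ γH h1 h2) v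

include hherm hanis he hsplit hnc hχ h1 h2 in
/-- **«`κ(γ, ψ_v(i(γ)))` is equal to `±1`»** at the pair, every finite `v` (★ (P-β) `finKappaAt_rationalComponent_eq_one_or_eq_neg_one_of_eval_ne_zero`). [cite: Rogawski1990, §14.6 p. 242] -/
theorem finKappaAt_singularPair_eq_one_or_eq_neg_one :
    finKappaAt L v H' (rationalComponent L γH v) ((UnitaryGroup.cmDatum L 3 H').toLocal v ((UnitaryGroup.cmDatum L 3 H').toAdelic γ₀)) = 1 ∨ finKappaAt L v H' (rationalComponent L γH v) ((UnitaryGroup.cmDatum L 3 H').toLocal v ((UnitaryGroup.cmDatum L 3 H').toAdelic γ₀)) = -1 :=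
  finKappaAt_rationalComponent_eq_one_or_eq_neg_one_of_eval_ne_zero L H' γH (eval_charpoly_singularPair_ne_zero L γH h1 h2 he) v _
    (isLocalNormPair_singularPair L H' hherm hanis γ₀ he hsplit hnc hχ γH h1 h2 v)

include he hsplit hnc h1 in
/-- **`κ_v = +1` AT A SPLIT PLACE** (`P_v ≠ 0`, ★ `finKappaAt_of_not_subsingleton`: «it is `+1` for almost all `v`»). [cite: Rogawski1990, §14.6 p. 242] -/
theorem finKappaAt_singularPair_of_not_subsingleton (hv : ¬ Subsingleton (UnitaryGroup.PlacesOver L v)) :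
    finKappaAt L v H' (rationalComponent L γH v) ((UnitaryGroup.cmDatum L 3 H').toLocal v ((UnitaryGroup.cmDatum L 3 H').toAdelic γ₀)) = 1 :=
  finKappaAt_of_not_subsingleton L v H' (rationalComponent L γH v) (finEigenlineProjector_singularPair_ne_zero L H' γ₀ he hsplit hnc γH h1 v) hv

/-- `Σ_i Σ_k σ(M_{ij}) H′_{ik} M_{kj} = ⟨M e_j, M e_j⟩_{H′}` (★ `hermForm`, conjugate-linear in the first variable; bookkeeping). [cite: Rogawski1990, §3.5 Prop. 3.5.2 (c) pp. 25–26] -/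
theorem sum_sum_eq_hermForm (M : Matrix (Fin 3) (Fin 3) L) (j : Fin 3) :
    (∑ i : Fin 3, ∑ k : Fin 3, IsCMField.complexConj L (M i j) * H' i k * M k j) = hermForm (cmConjRingHom L) H' (fun i => M i j) (fun i => M i j) := by
  simp only [hermForm, dotProduct, Matrix.mulVec, Function.comp_apply, Finset.mul_sum, mul_assoc]
  rfl

/-- `⟨c q, c q⟩_{H′} = c̄ c ⟨q, q⟩_{H′}` (sesquilinearity of ★ `hermForm`; bookkeeping). [cite: Rogawski1990, §3.5 pp. 25–26] -/
theorem hermForm_smul_self (c : L) (q : Fin 3 → L) :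
    hermForm (cmConjRingHom L) H' (c • q) (c • q) = cmConjRingHom L c * c * hermForm (cmConjRingHom L) H' q q := by
  have hcq : (⇑(cmConjRingHom L) ∘ (c • q)) = cmConjRingHom L c • (⇑(cmConjRingHom L) ∘ q) := by
    funext i
    simp only [Function.comp_apply, Pi.smul_apply, smul_eq_mul, map_mul]
  unfold hermForm
  rw [Matrix.mulVec_smul, dotProduct_smul, hcq, smul_dotProduct, smul_eq_mul, smul_eq_mul]
  ring

/-- **Norm classes are blind to global norms**: for `c ∈ L^×`, `(c̄ c t) ⊗ 1 = z z̄` for a unit `z` of `E_v` iff `t ⊗ 1` is so (★ `conjLocal_algebraMap`). [cite: Rogawski1990, §3.5 Prop. 3.5.2 (c) pp. 25–26] -/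
theorem exists_isUnit_norm_mul_iff (c t : L) (hc : c ≠ 0) :
    (∃ z : UnitaryGroup.LocalRing L v, IsUnit z ∧
        algebraMap L (UnitaryGroup.LocalRing L v) (cmConjRingHom L c * c * t) = z * UnitaryGroup.conjLocal L (IsCMField.complexConj L) v z) ↔
      (∃ z : UnitaryGroup.LocalRing L v, IsUnit z ∧
        algebraMap L (UnitaryGroup.LocalRing L v) t = z * UnitaryGroup.conjLocal L (IsCMField.complexConj L) v z) := by
  have ha : IsUnit (algebraMap L (UnitaryGroup.LocalRing L v) c) := (isUnit_iff_ne_zero.2 hc).map _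
  have hconj : UnitaryGroup.conjLocal L (IsCMField.complexConj L) v (algebraMap L (UnitaryGroup.LocalRing L v) c) =
      algebraMap L (UnitaryGroup.LocalRing L v) (cmConjRingHom L c) := conjLocal_algebraMap L v c
  obtain ⟨u, hu⟩ := ha
  constructor
  · rintro ⟨z, hz, h⟩
    refine ⟨z * ↑u⁻¹, hz.mul (Units.isUnit _), ?_⟩
    have hinv : (↑u⁻¹ : UnitaryGroup.LocalRing L v) * algebraMap L (UnitaryGroup.LocalRing L v) c = 1 := by rw [← hu, Units.inv_mul]
    have hinv' : UnitaryGroup.conjLocal L (IsCMField.complexConj L) v (↑u⁻¹ : UnitaryGroup.LocalRing L v) *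
        algebraMap L (UnitaryGroup.LocalRing L v) (cmConjRingHom L c) = 1 := by rw [← hconj, ← map_mul, hinv, map_one]
    rw [map_mul, map_mul] at h; rw [map_mul]
    linear_combination ((↑u⁻¹ : UnitaryGroup.LocalRing L v) * UnitaryGroup.conjLocal L (IsCMField.complexConj L) v (↑u⁻¹ : UnitaryGroup.LocalRing L v)) * h +
      (-(algebraMap L (UnitaryGroup.LocalRing L v) t * (UnitaryGroup.conjLocal L (IsCMField.complexConj L) v (↑u⁻¹ : UnitaryGroup.LocalRing L v) *
        algebraMap L (UnitaryGroup.LocalRing L v) (cmConjRingHom L c)))) * hinv + (-(algebraMap L (UnitaryGroup.LocalRing L v) t)) * hinv'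
  · rintro ⟨z, hz, h⟩
    refine ⟨z * algebraMap L (UnitaryGroup.LocalRing L v) c, hz.mul ⟨u, hu⟩, ?_⟩
    rw [map_mul, map_mul, h, map_mul (UnitaryGroup.conjLocal L (IsCMField.complexConj L) v), hconj]
    ring

include hherm hanis he hsplit hnc hχ h1 h2 in
open scoped Classical in
/-- **KOTTWITZ'S INVARIANT AT THE SINGULAR CLASS, FINITE NON-SPLIT `v`**: `κ_v((γ_H)_v, (γ₀)_v) = +1` iff the `H′`-LENGTH `⟨p, p⟩_{H′} ∈ L⁺` of a rational vector `p`
spanning the `e₂`-eigenline `ker(γ₀ − e₂) = im(γ₀ − e₁)` (any non-zero column `p = (γ₀ − e₁)·e_j`) is a NORM from the units of `E_v = L_w`, `−1` otherwise: ★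
`finKappaAt_of_fst_eq_smul_one_eq_ite` reads `κ_v` on the column `q_j = (e₂ − e₁) p_j ⊗ 1` of `P_v` (§2), ★ `finColumnFormValue_rationalComponent` makes `x_j = ⟨q_j, q_j⟩_{H′} ⊗ 1`,
and the global norm `N(e₂ − e₁)` is discarded by `exists_isUnit_norm_mul_iff` — the local Hilbert symbol `(⟨p, p⟩_{H′}, L∕L⁺)_v`, Kottwitz's invariant of the singular class.
[cite: Rogawski1990, §14.6 p. 242; §4.3 p. 43; §3.5 Prop. 3.5.2 (c) pp. 25–26] [cite: LanglandsShelstad1987, §2] -/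
theorem finKappaAt_singularPair_eq_ite_eigenline (hv : Subsingleton (UnitaryGroup.PlacesOver L v)) {j : Fin 3}
    (hj : ∃ i : Fin 3, ((((γ₀ : unitaryGroup (cmConjRingHom L) H').val : GL (Fin 3) L) : Matrix (Fin 3) (Fin 3) L) - e₁ • (1 : Matrix (Fin 3) (Fin 3) L)) i j ≠ 0) :
    finKappaAt L v H' (rationalComponent L γH v) ((UnitaryGroup.cmDatum L 3 H').toLocal v ((UnitaryGroup.cmDatum L 3 H').toAdelic γ₀)) =
      if ∃ z : UnitaryGroup.LocalRing L v, IsUnit z ∧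
          algebraMap L (UnitaryGroup.LocalRing L v) (hermForm (cmConjRingHom L) H' (fun i => ((((γ₀ : unitaryGroup (cmConjRingHom L) H').val : GL (Fin 3) L) : Matrix (Fin 3) (Fin 3) L) - e₁ • (1 : Matrix (Fin 3) (Fin 3) L)) i j) (fun i => ((((γ₀ : unitaryGroup (cmConjRingHom L) H').val : GL (Fin 3) L) : Matrix (Fin 3) (Fin 3) L) - e₁ • (1 : Matrix (Fin 3) (Fin 3) L)) i j)) =
            z * UnitaryGroup.conjLocal L (IsCMField.complexConj L) v z
      then 1 else -1 := by
  have hu : IsUnit (finGammaTwo L v (rationalComponent L γH v) - algebraMap L (UnitaryGroup.LocalRing L v) e₁) := by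
    rw [finGammaTwo_singularPair L γH h2 v, ← map_sub]
    exact (isUnit_iff_ne_zero.2 (sub_ne_zero.2 he.symm)).map _
  rw [finKappaAt_of_fst_eq_smul_one_eq_ite L v H' (rationalComponent L γH v) (coe_fst_singularPair L γH h1 v) ((UnitaryGroup.cmDatum L 3 H').toLocal v ((UnitaryGroup.cmDatum L 3 H').toAdelic γ₀)) hv
    (isLocalNormPair_singularPair L H' hherm hanis γ₀ he hsplit hnc hχ γH h1 h2 v) hu (column_sq_ne_zero L H' γ₀ he hsplit v hj),
    finColumnFormValue_rationalComponent]
  simp only [globalProjector_singularPair L H' γ₀ hsplit γH h1]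
  rw [sum_sum_eq_hermForm]
  have hq : (fun i => ((e₂ - e₁) • ((((γ₀ : unitaryGroup (cmConjRingHom L) H').val : GL (Fin 3) L) : Matrix (Fin 3) (Fin 3) L) - e₁ • (1 : Matrix (Fin 3) (Fin 3) L))) i j) =
      (e₂ - e₁) • (fun i => ((((γ₀ : unitaryGroup (cmConjRingHom L) H').val : GL (Fin 3) L) : Matrix (Fin 3) (Fin 3) L) - e₁ • (1 : Matrix (Fin 3) (Fin 3) L)) i j) := rfl
  rw [hq, hermForm_smul_self, exists_isUnit_norm_mul_iff L v (e₂ - e₁) _ (sub_ne_zero.2 he.symm)]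

/-! ## §4 `Δ‴_v` at the pair: `Δ‴_v = τ_v · (D_v κ_v)`, `D_v κ_v ∈ ℝ^×` (`> 0` at split `v`) — in the sockets' spelling -/

include hherm hanis he hsplit hnc hχ h1 h2 in
open scoped Classical in
/-- **`Δ‴_v((γ_H)_v, (γ₀)_v) = τ_v · (D_v κ_v)`** at the pair, `D_v κ_v` REAL (★ `finExplicitDelta_of_isLocalNormPair` at §3's matching). [cite: Rogawski1990, §4.9 p. 55; §14.6 p. 242] -/
theorem finExplicitDelta_singularPair_eq (μ : HeckeCharacter L) :
    finExplicitDelta L v H' ((UnitaryGroup.cmDatum L 2 (Matrix.of fun i j : Fin 2 => if i.val + j.val + 1 = 2 then (1 : L) else 0)).toLocal v ((UnitaryGroup.cmDatum L 2 (Matrix.of fun i j : Fin 2 => if i.val + j.val + 1 = 2 then (1 : L) else 0)).toAdelic γH.1),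
        (UnitaryGroup.cmDatum L 1 (Matrix.of fun i j : Fin 1 => if i.val + j.val + 1 = 1 then (1 : L) else 0)).toLocal v ((UnitaryGroup.cmDatum L 1 (Matrix.of fun i j : Fin 1 => if i.val + j.val + 1 = 1 then (1 : L) else 0)).toAdelic γH.2)) μ ((UnitaryGroup.cmDatum L 3 H').toLocal v ((UnitaryGroup.cmDatum L 3 H').toAdelic γ₀)) =
      finTau L v ((UnitaryGroup.cmDatum L 2 (Matrix.of fun i j : Fin 2 => if i.val + j.val + 1 = 2 then (1 : L) else 0)).toLocal v ((UnitaryGroup.cmDatum L 2 (Matrix.of fun i j : Fin 2 => if i.val + j.val + 1 = 2 then (1 : L) else 0)).toAdelic γH.1),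
        (UnitaryGroup.cmDatum L 1 (Matrix.of fun i j : Fin 1 => if i.val + j.val + 1 = 1 then (1 : L) else 0)).toLocal v ((UnitaryGroup.cmDatum L 1 (Matrix.of fun i j : Fin 1 => if i.val + j.val + 1 = 1 then (1 : L) else 0)).toAdelic γH.2)) μ *
        ((finWeylRatio L v ((UnitaryGroup.cmDatum L 2 (Matrix.of fun i j : Fin 2 => if i.val + j.val + 1 = 2 then (1 : L) else 0)).toLocal v ((UnitaryGroup.cmDatum L 2 (Matrix.of fun i j : Fin 2 => if i.val + j.val + 1 = 2 then (1 : L) else 0)).toAdelic γH.1),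
        (UnitaryGroup.cmDatum L 1 (Matrix.of fun i j : Fin 1 => if i.val + j.val + 1 = 1 then (1 : L) else 0)).toLocal v ((UnitaryGroup.cmDatum L 1 (Matrix.of fun i j : Fin 1 => if i.val + j.val + 1 = 1 then (1 : L) else 0)).toAdelic γH.2)) * (finKappaAt L v H' ((UnitaryGroup.cmDatum L 2 (Matrix.of fun i j : Fin 2 => if i.val + j.val + 1 = 2 then (1 : L) else 0)).toLocal v ((UnitaryGroup.cmDatum L 2 (Matrix.of fun i j : Fin 2 => if i.val + j.val + 1 = 2 then (1 : L) else 0)).toAdelic γH.1),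
        (UnitaryGroup.cmDatum L 1 (Matrix.of fun i j : Fin 1 => if i.val + j.val + 1 = 1 then (1 : L) else 0)).toLocal v ((UnitaryGroup.cmDatum L 1 (Matrix.of fun i j : Fin 1 => if i.val + j.val + 1 = 1 then (1 : L) else 0)).toAdelic γH.2)) ((UnitaryGroup.cmDatum L 3 H').toLocal v ((UnitaryGroup.cmDatum L 3 H').toAdelic γ₀)) : ℝ) : ℝ) : ℂ) := by
  change finExplicitDelta L v H' (rationalComponent L γH v) μ ((UnitaryGroup.cmDatum L 3 H').toLocal v ((UnitaryGroup.cmDatum L 3 H').toAdelic γ₀)) =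
    finTau L v (rationalComponent L γH v) μ * ((finWeylRatio L v (rationalComponent L γH v) * (finKappaAt L v H' (rationalComponent L γH v) ((UnitaryGroup.cmDatum L 3 H').toLocal v ((UnitaryGroup.cmDatum L 3 H').toAdelic γ₀)) : ℝ) : ℝ) : ℂ)
  rw [finExplicitDelta_of_isLocalNormPair L v H' (rationalComponent L γH v) μ (isLocalNormPair_singularPair L H' hherm hanis γ₀ he hsplit hnc hχ γH h1 h2 v)]
  push_cast
  ring

include hherm hanis he hsplit hnc hχ h1 h2 in
open scoped Classical in
/-- **THE PHASE OF `Δ‴_v` AT THE PAIR IS THAT OF `τ_v`**: `Δ‴_v = τ_v · r`, `r = D_v κ_v ∈ ℝ^×` — the input of the phase pins #2∕#4. [cite: Rogawski1990, §8.2 Prop. 8.2.1 (a) p. 118; §4.9 p. 55] -/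
theorem finExplicitDelta_singularPair_eq_tau_mul_real (μ : HeckeCharacter L) :
    ∃ r : ℝ, r ≠ 0 ∧ finExplicitDelta L v H' ((UnitaryGroup.cmDatum L 2 (Matrix.of fun i j : Fin 2 => if i.val + j.val + 1 = 2 then (1 : L) else 0)).toLocal v ((UnitaryGroup.cmDatum L 2 (Matrix.of fun i j : Fin 2 => if i.val + j.val + 1 = 2 then (1 : L) else 0)).toAdelic γH.1),
        (UnitaryGroup.cmDatum L 1 (Matrix.of fun i j : Fin 1 => if i.val + j.val + 1 = 1 then (1 : L) else 0)).toLocal v ((UnitaryGroup.cmDatum L 1 (Matrix.of fun i j : Fin 1 => if i.val + j.val + 1 = 1 then (1 : L) else 0)).toAdelic γH.2)) μ ((UnitaryGroup.cmDatum L 3 H').toLocal v ((UnitaryGroup.cmDatum L 3 H').toAdelic γ₀)) = finTau L v ((UnitaryGroup.cmDatum L 2 (Matrix.of fun i j : Fin 2 => if i.val + j.val + 1 = 2 then (1 : L) else 0)).toLocal v ((UnitaryGroup.cmDatum L 2 (Matrix.of fun i j : Fin 2 => if i.val + j.val + 1 = 2 then (1 : L) else 0)).toAdelic γH.1),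
        (UnitaryGroup.cmDatum L 1 (Matrix.of fun i j : Fin 1 => if i.val + j.val + 1 = 1 then (1 : L) else 0)).toLocal v ((UnitaryGroup.cmDatum L 1 (Matrix.of fun i j : Fin 1 => if i.val + j.val + 1 = 1 then (1 : L) else 0)).toAdelic γH.2)) μ * (r : ℂ) := by
  refine ⟨finWeylRatio L v (rationalComponent L γH v) * (finKappaAt L v H' (rationalComponent L γH v) ((UnitaryGroup.cmDatum L 3 H').toLocal v ((UnitaryGroup.cmDatum L 3 H').toAdelic γ₀)) : ℝ), ?_,
    finExplicitDelta_singularPair_eq L H' hherm hanis γ₀ he hsplit hnc hχ γH h1 h2 v μ⟩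
  refine mul_ne_zero (finWeylRatio_singularPair_pos L γH h1 h2 v he).ne' ?_
  rcases finKappaAt_singularPair_eq_one_or_eq_neg_one L H' hherm hanis γ₀ he hsplit hnc hχ γH h1 h2 v with h | h
  · rw [h]; norm_num
  · rw [h]; norm_num

include hherm hanis he hsplit hnc hχ h1 h2 in
open scoped Classical in
/-- **At a SPLIT place the phase factor is POSITIVE**: `Δ‴_v = τ_v · D_v`, `D_v = ‖e₂ − e₁‖_w²∕(‖e₁‖_w‖e₂‖_w) > 0` (`κ_v = +1`) — #2's `0 < r`. [cite: Rogawski1990, Lemma 4.13.1 p. 64; Prop. 8.2.1 (a) p. 118] -/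
theorem finExplicitDelta_singularPair_eq_tau_mul_pos_of_not_subsingleton (μ : HeckeCharacter L) (hv : ¬ Subsingleton (UnitaryGroup.PlacesOver L v)) :
    ∃ r : ℝ, 0 < r ∧ finExplicitDelta L v H' ((UnitaryGroup.cmDatum L 2 (Matrix.of fun i j : Fin 2 => if i.val + j.val + 1 = 2 then (1 : L) else 0)).toLocal v ((UnitaryGroup.cmDatum L 2 (Matrix.of fun i j : Fin 2 => if i.val + j.val + 1 = 2 then (1 : L) else 0)).toAdelic γH.1),
        (UnitaryGroup.cmDatum L 1 (Matrix.of fun i j : Fin 1 => if i.val + j.val + 1 = 1 then (1 : L) else 0)).toLocal v ((UnitaryGroup.cmDatum L 1 (Matrix.of fun i j : Fin 1 => if i.val + j.val + 1 = 1 then (1 : L) else 0)).toAdelic γH.2)) μ ((UnitaryGroup.cmDatum L 3 H').toLocal v ((UnitaryGroup.cmDatum L 3 H').toAdelic γ₀)) = finTau L v ((UnitaryGroup.cmDatum L 2 (Matrix.of fun i j : Fin 2 => if i.val + j.val + 1 = 2 then (1 : L) else 0)).toLocal v ((UnitaryGroup.cmDatum L 2 (Matrix.of fun i j : Fin 2 =>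 if i.val + j.val + 1 = 2 then (1 : L) else 0)).toAdelic γH.1),
        (UnitaryGroup.cmDatum L 1 (Matrix.of fun i j : Fin 1 => if i.val + j.val + 1 = 1 then (1 : L) else 0)).toLocal v ((UnitaryGroup.cmDatum L 1 (Matrix.of fun i j : Fin 1 => if i.val + j.val + 1 = 1 then (1 : L) else 0)).toAdelic γH.2)) μ * (r : ℂ) := by
  refine ⟨finWeylRatio L v (rationalComponent L γH v), finWeylRatio_singularPair_pos L γH h1 h2 v he, ?_⟩
  rw [finExplicitDelta_singularPair_eq L H' hherm hanis γ₀ he hsplit hnc hχ γH h1 h2 v μ]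
  change finTau L v (rationalComponent L γH v) μ * ((finWeylRatio L v (rationalComponent L γH v) * (finKappaAt L v H' (rationalComponent L γH v) ((UnitaryGroup.cmDatum L 3 H').toLocal v ((UnitaryGroup.cmDatum L 3 H').toAdelic γ₀)) : ℝ) : ℝ) : ℂ) = _
  rw [finKappaAt_singularPair_of_not_subsingleton L H' γ₀ he hsplit hnc γH h1 v hv, Int.cast_one, mul_one]
  rfl

include hherm hanis he hsplit hnc hχ h1 h2 in
open scoped Classical in
/-- **`Δ‴_v((γ_H)_v, (γ₀)_v) ≠ 0`** (socket #15's finite half, frame-free: ★ (P-β) `finExplicitDelta_rationalComponent_ne_zero_of_eval_ne_zero`). [cite: Rogawski1990, §4.9 p. 55; Prop. 8.2.1 p. 119] -/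
theorem finExplicitDelta_singularPair_ne_zero (μ : HeckeCharacter L) : finExplicitDelta L v H' ((UnitaryGroup.cmDatum L 2 (Matrix.of fun i j : Fin 2 => if i.val + j.val + 1 = 2 then (1 : L) else 0)).toLocal v ((UnitaryGroup.cmDatum L 2 (Matrix.of fun i j : Fin 2 => if i.val + j.val + 1 = 2 then (1 : L) else 0)).toAdelic γH.1),
        (UnitaryGroup.cmDatum L 1 (Matrix.of fun i j : Fin 1 => if i.val + j.val + 1 = 1 then (1 : L) else 0)).toLocal v ((UnitaryGroup.cmDatum L 1 (Matrix.of fun i j : Fin 1 => if i.val + j.val + 1 = 1 then (1 : L) else 0)).toAdelic γH.2)) μ ((UnitaryGroup.cmDatum L 3 H').toLocal v ((UnitaryGroup.cmDatum L 3 H').toAdelic γ₀)) ≠ 0 :=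
  finExplicitDelta_rationalComponent_ne_zero_of_eval_ne_zero L H' γH μ (eval_charpoly_singularPair_ne_zero L γH h1 h2 he) v _
    (isLocalNormPair_singularPair L H' hherm hanis γ₀ he hsplit hnc hχ γH h1 h2 v)

end Pair

end Summit.HodgeConjecture.HodgeConjecture.Cruxes.H413.K2E4SingularPairWeylKappaValues

end
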